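import Mathlib
import HarnessLib
import Summits.HubbardSuperconductivity.HubbardSuperconductivity.Theorems.KLProgrammeKLRegimeTwoVolumeTowerScaleSmallGeom

/-!
# Route `KLProgramme` — crux K3, VL child `KLRegimeVolumeLimitV17F2` (stmt-HubbardSuperconductivity-20440), blueprint v5 M5: (H2)–(H3) OF `TowerData` ACROSS
# SCALES FROM PER-SCALE GEOMETRIC MAJORANTS (seat hubbard-kl-k3c4-p1 g14; `--supports` 20440)

Sequel of `…TwoVolumeTowerScaleSmallGeom` (one scale).  The data package `…TowerDataDefs.TowerData β U μ` carries, besides the three data bundles and the base,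
the L-free budgets `NV` (E1's even profiles), `NS` (raw profiles of the states), their recursion (H2) `NS 0 k = [Even k]·NV 0 (k/2)`,
`NS (j+1) k = (ρ₀ j)⁻¹^k · e·ν₀ j / (1 − e·aW j·ν₀ j/κ j²)`, and the per-scale smallness (H3) `TowerScaleSmall … (NV j) (NS j) (ν₀ j) … (ν₈ j)` for `j < J`
(`J = nScales β`).  Here all of that is produced at once from per-scale GEOMETRIC MAJORANTS of E1's profiles `NV j m ≤ A j·(q j)^m` and per-scale scalar
conditions: the raw-profile majorants are `Bm 0 = A 0`, `τ 0 = q 0` at scale `0` and `Bm (j+1) ≥ Db j`, `τ (j+1) ≥ (ρ₀ j)⁻²` at scale `j+1` — the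
measuring radius `ρ₀ j` of scale `j` is the geometric ratio of scale `j+1`'s raw profile, which is how the transfer constant `cW (j+1)` constrains `ρ₀ j`
from below («cW-BUDGET», KL STATUS 2026-08-28 l.4865/l.5212; no structural cap).

* **`towerSmallness_of_geom`** — `∃ NS ν₀ … ν₈` with the four fields `hNSnn`, `hNS0`, `hNSsucc`, `hsm` of `TowerData` for `j < J`; feed them to
  `…TwoVolumeTowerDataOfPartsDeg.towerData_of_partsD`.

Proofs only; no definition; nothing about the model is asserted. [folklore: geometric series bookkeeping]
-/

noncomputable section

namespace Summit.HubbardSuperconductivity.HubbardSuperconductivity.Theorems.TwoVolumeSource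

set_option linter.dupNamespace false -- summit = problem name (single-conjunct summit), D-0017

open Finset Filter Topology

/-! ## §4 Across scales: the raw budgets by the recursion (H2) and (H3) at every step -/

/-- **(H2)–(H3) OF `TowerData` FROM PER-SCALE GEOMETRIC MAJORANTS** (see the module docstring).  Inputs per scale `j`: the constants, E1's even profile
`NV j ≤ A j·(q j)^m`, majorants `Bm j, τ j` of the raw profile of the states (scale `0`: `A 0 ≤ Bm 0`, `q 0 ≤ τ 0`; scale `j+1`: `Db j ≤ Bm (j+1)`,
`(ρ₀ j)⁻² ≤ τ (j+1)` — THIS is where the previous measuring radius enters), and the conditions of `towerScaleSmall_of_geom` at every `j < J`.  Output: the raw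
budgets `NS` (defined by the recursion (H2) from the first series `ν₀ j = Σ_m (e²(κ_j+ρ₀_j))^{2m} NV j m`) and series values with the four fields `hNSnn`,
`hNS0`, `hNSsucc`, `hsm` of `…TowerDataDefs.TowerData` (`J = nScales β`). [folklore: geometric series] -/
theorem towerSmallness_of_geom (J : ℕ) (κ κ' aW aW' cW κf cRb cCb δb ρ₀ ρf ρ₂ ρ' ρ₃ A q Bm τ nb₀ Db nb₃ nbS nbE nb₇ nb₈ : ℕ → ℝ) (NV : ℕ → ℕ → ℝ)
    (hκ : ∀ j, 0 < κ j) (haW : ∀ j, 0 ≤ aW j) (haW' : ∀ j, 0 ≤ aW' j) (hcW : ∀ j, 1 ≤ cW j) (hcRb : ∀ j, 0 ≤ cRb j) (hcCb : ∀ j, 0 ≤ cCb j)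
    (hδb : ∀ j, 0 ≤ δb j) (hρ₀ : ∀ j, 0 < ρ₀ j) (hq : ∀ j, 0 ≤ q j) (hτ : ∀ j, 0 ≤ τ j)
    (hNV0 : ∀ j m, 0 ≤ NV j m) (hNV : ∀ j m, NV j m ≤ A j * q j ^ m)
    -- the raw-profile majorants: scale `0` from E1's scale-`0` profile, scale `j+1` from scale `j`'s next raw budget measured at `ρ₀ j`
    (hB0 : A 0 ≤ Bm 0) (hτ0 : q 0 ≤ τ 0)
    (hBsucc : ∀ j, j + 1 < J → Db j ≤ Bm (j + 1)) (hτsucc : ∀ j, j + 1 < J → (ρ₀ j)⁻¹ ^ 2 ≤ τ (j + 1))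
    -- the six ratios, per scale
    (hr₀ : ∀ j, j < J → (Real.exp 2 * (κ j + ρ₀ j)) ^ 2 * q j < 1)
    (hr₅ : ∀ j, j < J → (Real.exp 2 * (κ' j + κ j + ρf j)) ^ 2 * (ρ₀ j)⁻¹ ^ 2 < 1)
    (hr₄ : ∀ j, j < J → (Real.exp 2 * (κ' j + κ j + (κ' j + κ j + (κ' j + κ j)) + ρ₂ j)) ^ 2 * (ρ₀ j)⁻¹ ^ 2 < 1)
    (hr₁ : ∀ j, j < J → (Real.exp 2 * (κ' j + ρ' j)) ^ 2 * q j < 1)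
    (hx₁ : ∀ j, j < J → (Real.exp 2 * (κ' j + ρ' j)) ^ 2 * (cW j ^ 2 * τ j) < 1)
    (hy₆ : ∀ j, j < J → (Real.exp 2 * (κf j + ρ₃ j)) ^ 2 * ((cW j + δb j) ^ 2 * τ j) < 1)
    -- the majorants, per scale
    (hnb₀ : ∀ j, j < J → A j / (1 - (Real.exp 2 * (κ j + ρ₀ j)) ^ 2 * q j) ≤ nb₀ j)
    (hDb : ∀ j, j < J → Real.exp 1 * nb₀ j / (1 - Real.exp 1 * aW j * nb₀ j / κ j ^ 2) ≤ Db j)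
    (hnb₃ : ∀ j, j < J → A j / (1 - (Real.exp 2 * (κ' j + ρ' j)) ^ 2 * q j) ≤ nb₃ j)
    (hnbS : ∀ j, j < J → cW j * Bm j / (1 - (Real.exp 2 * (κ' j + ρ' j)) ^ 2 * (cW j ^ 2 * τ j)) ≤ nbS j)
    (hnbE : ∀ j, j < J → cW j * Bm j * (6 / (1 - (Real.exp 2 * (κ' j + ρ' j)) ^ 2 * (cW j ^ 2 * τ j)) +
      14 * ((Real.exp 2 * (κ' j + ρ' j)) ^ 2 * (cW j ^ 2 * τ j) / (1 - (Real.exp 2 * (κ' j + ρ' j)) ^ 2 * (cW j ^ 2 * τ j)) ^ 2)) ≤ nbE j)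
    (hnb₇ : ∀ j, j < J → cW j * Bm j / (1 - (Real.exp 2 * (κf j + ρ₃ j)) ^ 2 * (cW j ^ 2 * τ j)) ≤ nb₇ j)
    (hnb₈ : ∀ j, j < J → 2 * Bm j * ((Real.exp 2 * (κf j + ρ₃ j)) ^ 2 * ((cW j + δb j) ^ 2 * τ j) /
      (1 - (Real.exp 2 * (κf j + ρ₃ j)) ^ 2 * ((cW j + δb j) ^ 2 * τ j)) ^ 2) ≤ nb₈ j)
    -- the five smallness lines, per scale
    (hθ₀ : ∀ j, j < J → Real.exp 1 * aW j * nb₀ j / κ j ^ 2 < 1)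
    (hθw : ∀ j, j < J → Real.exp 1 * (aW' j + aW j + (aW' j + aW j)) * (Db j / (1 - (Real.exp 2 * (κ' j + κ j + ρf j)) ^ 2 * (ρ₀ j)⁻¹ ^ 2)) /
      (κ' j + κ j) ^ 2 < 1)
    (hθ₂ : ∀ j, j < J → Real.exp 1 * (aW' j + aW j + (aW' j + aW j)) *
      (Db j / (1 - (Real.exp 2 * (κ' j + κ j + (κ' j + κ j + (κ' j + κ j)) + ρ₂ j)) ^ 2 * (ρ₀ j)⁻¹ ^ 2)) / (κ' j + κ j + (κ' j + κ j + (κ' j + κ j))) ^ 2 < 1)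
    (hbar : ∀ j, j < J → Real.exp 1 * aW' j * ((nb₃ j + (nbS j + nb₃ j)) + nbE j) / κ' j ^ 2 < 1)
    (hθf : ∀ j, j < J → Real.exp 1 * (aW' j + (cRb j + cCb j)) * (nb₇ j + δb j * nb₈ j) / κf j ^ 2 < 1) :
    ∃ (NS : ℕ → ℕ → ℝ) (ν₀ ν₁ ν₂ ν₃ ν₄ ν₅ νE ν₆ ν₇ ν₈ : ℕ → ℝ),
      (∀ j k, 0 ≤ NS j k) ∧ (∀ k, NS 0 k = if Even k then NV 0 (k / 2) else 0) ∧
      (∀ j k, j < J → NS (j + 1) k = (ρ₀ j)⁻¹ ^ k * (Real.exp 1 * ν₀ j) / (1 - Real.exp 1 * aW j * ν₀ j / κ j ^ 2)) ∧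
      (∀ j, j < J → TowerScaleSmall (κ j) (κ' j) (aW j) (aW' j) (cW j) (κf j) (cRb j) (cCb j) (δb j) (ρ₀ j) (ρf j) (ρ₂ j) (ρ' j) (ρ₃ j)
        (NV j) (NS j) (ν₀ j) (ν₁ j) (ν₂ j) (ν₃ j) (ν₄ j) (ν₅ j) (νE j) (ν₆ j) (ν₇ j) (ν₈ j)) := by
  classical
  -- the first series of every scale
  obtain ⟨ν₀, hν₀def⟩ : ∃ ν₀ : ℕ → ℝ, ν₀ = fun j => ∑' m, (Real.exp 2 * (κ j + ρ₀ j)) ^ (2 * m) * NV j m := ⟨_, rfl⟩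
  have hν₀sum : ∀ j, j < J → HasSum (fun m => (Real.exp 2 * (κ j + ρ₀ j)) ^ (2 * m) * NV j m) (ν₀ j) := fun j hj => by
    have hw : 0 ≤ (Real.exp 2 * (κ j + ρ₀ j)) ^ 2 := sq_nonneg _
    have h := (summable_hasSum_le_of_le (f := fun m => (Real.exp 2 * (κ j + ρ₀ j)) ^ (2 * m) * NV j m)
      (g := fun m => A j * ((Real.exp 2 * (κ j + ρ₀ j)) ^ 2 * q j) ^ m)
      (fun m => mul_nonneg (by rw [pow_mul]; exact pow_nonneg hw m) (hNV0 j m))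
      (fun m => by
        rw [pow_mul]
        calc ((Real.exp 2 * (κ j + ρ₀ j)) ^ 2) ^ m * NV j m ≤ ((Real.exp 2 * (κ j + ρ₀ j)) ^ 2) ^ m * (A j * q j ^ m) :=
              mul_le_mul_of_nonneg_left (hNV j m) (pow_nonneg hw m)
          _ = A j * ((Real.exp 2 * (κ j + ρ₀ j)) ^ 2 * q j) ^ m := by rw [mul_pow ((Real.exp 2 * (κ j + ρ₀ j)) ^ 2) (q j) m, mul_left_comm])
      (hasSum_const_mul_geometric (mul_nonneg hw (hq j)) (hr₀ j hj))).1
    rw [hν₀def]; exact h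
  have hb : ∀ j, j < J → 0 ≤ ν₀ j ∧ ν₀ j ≤ nb₀ j := fun j hj => towerScale_nu0_le (hq j) (hNV0 j) (hNV j) (hν₀sum j hj) (hr₀ j hj) (hnb₀ j hj)
  have hD : ∀ j, j < J → Real.exp 1 * aW j * ν₀ j / κ j ^ 2 < 1 ∧ 0 ≤ Real.exp 1 * ν₀ j / (1 - Real.exp 1 * aW j * ν₀ j / κ j ^ 2) ∧
      Real.exp 1 * ν₀ j / (1 - Real.exp 1 * aW j * ν₀ j / κ j ^ 2) ≤ Db j := fun j hj =>
    towerScale_D_bounds (hκ j) (haW j) (hb j hj).1 (hb j hj).2 (hθ₀ j hj) (hDb j hj)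
  -- the raw budgets by the recursion (H2)
  obtain ⟨NS, hNSdef⟩ : ∃ NS : ℕ → ℕ → ℝ, NS = fun j k => if j = 0 then (if Even k then NV 0 (k / 2) else 0) else
      (if j - 1 < J then (ρ₀ (j - 1))⁻¹ ^ k * (Real.exp 1 * ν₀ (j - 1)) / (1 - Real.exp 1 * aW (j - 1) * ν₀ (j - 1) / κ (j - 1) ^ 2) else 0) := ⟨_, rfl⟩
  have hNS0 : ∀ k, NS 0 k = if Even k then NV 0 (k / 2) else 0 := fun k => by rw [hNSdef]; simp
  have hNSsucc : ∀ j k, j < J → NS (j + 1) k = (ρ₀ j)⁻¹ ^ k * (Real.exp 1 * ν₀ j) / (1 - Real.exp 1 * aW j * ν₀ j / κ j ^ 2) := fun j k hj => by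
    rw [hNSdef]; simp [hj]
  have hNSsucc' : ∀ j k, ¬ j < J → NS (j + 1) k = 0 := fun j k hj => by rw [hNSdef]; simp [hj]
  have hNSnn : ∀ j k, 0 ≤ NS j k := by
    intro j k
    rcases j with _ | j
    · rw [hNS0]; split_ifs
      · exact hNV0 0 _
      · exact le_rfl
    · by_cases hj : j < J
      · rw [hNSsucc j k hj, mul_div_assoc]
        exact mul_nonneg (pow_nonneg (inv_nonneg.2 (hρ₀ j).le) _) (hD j hj).2.1
      · rw [hNSsucc' j k hj]
  -- the raw-profile majorants at every scale `j < J`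
  have hA0 : 0 ≤ A 0 := le_trans (hNV0 0 0) (by simpa using hNV 0 0)
  have hmaj : ∀ j, j < J → ∀ m, NS j (2 * m) ≤ Bm j * τ j ^ m := by
    intro j hj m
    rcases j with _ | j
    · rw [hNS0, if_pos (even_two_mul m), Nat.mul_div_cancel_left m two_pos]
      calc NV 0 m ≤ A 0 * q 0 ^ m := hNV 0 m
        _ ≤ Bm 0 * q 0 ^ m := mul_le_mul_of_nonneg_right hB0 (pow_nonneg (hq 0) m)
        _ ≤ Bm 0 * τ 0 ^ m := mul_le_mul_of_nonneg_left (pow_le_pow_left₀ (hq 0) hτ0 m) (hA0.trans hB0)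
    · have hj' : j < J := lt_trans (Nat.lt_succ_self j) hj
      rw [hNSsucc j _ hj', mul_div_assoc, pow_mul, mul_comm]
      exact mul_le_mul ((hD j hj').2.2.trans (hBsucc j hj)) (pow_le_pow_left₀ (sq_nonneg _) (hτsucc j hj) m) (pow_nonneg (sq_nonneg _) m)
        ((hD j hj').2.1.trans ((hD j hj').2.2.trans (hBsucc j hj)))
  -- (H3) at every scale
  have hsm : ∀ j, j < J → ∃ ν₁ ν₂ ν₃ ν₄ ν₅ νE ν₆ ν₇ ν₈ : ℝ,
      TowerScaleSmall (κ j) (κ' j) (aW j) (aW' j) (cW j) (κf j) (cRb j) (cCb j) (δb j) (ρ₀ j) (ρf j) (ρ₂ j) (ρ' j) (ρ₃ j)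
        (NV j) (NS j) (ν₀ j) ν₁ ν₂ ν₃ ν₄ ν₅ νE ν₆ ν₇ ν₈ := fun j hj =>
    towerScaleSmall_of_geom (hκ j) (haW j) (haW' j) (hcW j) (hcRb j) (hcCb j) (hδb j) (hq j) (hτ j) (hNV0 j) (hNV j)
      (fun m => hNSnn j (2 * m)) (hmaj j hj) (hν₀sum j hj) (hr₀ j hj) (hr₅ j hj) (hr₄ j hj) (hr₁ j hj) (hx₁ j hj) (hy₆ j hj) (hnb₀ j hj) (hDb j hj)
      (hnb₃ j hj) (hnbS j hj) (hnbE j hj) (hnb₇ j hj) (hnb₈ j hj) (hθ₀ j hj) (hθw j hj) (hθ₂ j hj) (hbar j hj) (hθf j hj)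
  choose! ν₁ ν₂ ν₃ ν₄ ν₅ νE ν₆ ν₇ ν₈ hsm using hsm
  exact ⟨NS, ν₀, ν₁, ν₂, ν₃, ν₄, ν₅, νE, ν₆, ν₇, ν₈, hNSnn, hNS0, hNSsucc, hsm⟩

end Summit.HubbardSuperconductivity.HubbardSuperconductivity.Theorems.TwoVolumeSource

end
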